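import Summits.BirchSwinnertonDyer.BirchSwinnertonDyer.Theorems.ManinLocalTwoThreeKummerDiamondFourSet
import Summits.BirchSwinnertonDyer.BirchSwinnertonDyer.Theorems.ManinLocalTwoThreeKummerDiamondStepTwoDiamondHalf
import HarnessLib

/-!
# es's STEP 2 (D6), VIII: the KUMMER SUBGROUP `𝒱 = {σ ↦ σS − S : 2S ∈ T}` is finite of order `≤ |T[2]| ≤ 4` (STEP 1, abstract), and
# `|W₀(ℂ)[2]| ≤ 4` by uniformisation
(route `ManinLocalTwoThree`, crux C2 `ManinOddAtFour` stmt-BirchSwinnertonDyer-22967; cell bsd-f2-manin, prover p2 gen 21; LEAD card `kummer_diamond` nodes D3/D4 ⟹ the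
`𝒱`-hypotheses of `StepTwo.propositionA_complex`; es g38 PROOF-Ees185-186.md §4 STEP 1 «`T ∩ 2E₀(ℚ) = 2T`, so `V_tors ≅ T/2T` has order 4»;
`--supports stmt-BirchSwinnertonDyer-22967`)

* `exists_kummerSubgroup` — ABSTRACT: `P` an additive group (the points `W₀(ℂ)`) with operators `ρ σ : P →+ P` (`σ ∈ Aut(ℂ/ℚ)`), `T ≤ P` a FINITE
  subgroup fixed pointwise by every `ρ σ` (rational torsion points) and containing `P[2]` (full rational `2`-torsion), `|T[2]| ≤ 4`: there is a finite
  subgroup `𝒱` of functions `σ ↦ ρ σ S − S` with `Nat.card 𝒱 ≤ 4` containing the Kummer class of every `S` with `2S ∈ T` (the class only depends on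
  `2S mod 2T`, and `|T/2T| = |T[2]|`, LEAD p760613 `card_quotient_two_eq_card_twoTorsion`).
* `ncard_twoTorsion_le_four` — CONCRETE: for any `X₀(N)`-datum `D₀` of `W₀`, `{S ∈ W₀(ℂ) : 2S = 0}` has at most four elements (`π₀` is onto and
  `2z ∈ Λ ⟹ π₀(z) ∈ {π₀(0), π₀(ω₁/2), π₀(ω₂/2), π₀((ω₁+ω₂)/2)}`), and `natCard_ker_two_le_four` — hence `|T[2]| ≤ 4` for every subgroup `T` of `W₀(ℂ)`.
UNCONDITIONAL; nothing about E-es-185, C2, Manin's conjecture or BSD is proved.  No definitions, no sorry. [cite: SilvermanAEC2009, Prop. X.1.4]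
[cite: Stevens1989, §2]
-/

set_option autoImplicit false
-- lint-debt: the directory name repeats the summit name (sibling precedent `ManinLocalTwoThreeKummerDiamondFourSet.lean`)
set_option linter.dupNamespace false

noncomputable section

open scoped MatrixGroups
open CongruenceSubgroup WeierstrassCurve Literature.NumberTheory.EllipticCurves Literature.NumberTheory.EllipticCurves.ModularForms

namespace Summit.BirchSwinnertonDyer.BirchSwinnertonDyer.Theorems.ManinLocalTwoThree.StepTwo

/-! ## §1 The Kummer subgroup (abstract STEP 1) -/

/-- **The Kummer subgroup is finite of order `≤ |T[2]| ≤ 4`.**  See the module docstring. [cite: SilvermanAEC2009, Prop. X.1.4] -/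
theorem exists_kummerSubgroup {G P : Type*} [AddCommGroup P] (ρ : G → P →+ P) (T : AddSubgroup P) [Finite T]
    (hfix : ∀ σ : G, ∀ t ∈ T, ρ σ t = t) (h2tors : ∀ S : P, 2 • S = 0 → S ∈ T)
    (h4 : Nat.card (nsmulAddMonoidHom 2 : T →+ T).ker ≤ 4) :
    ∃ 𝒱 : AddSubgroup (G → P), (𝒱 : Set (G → P)).Finite ∧ Nat.card 𝒱 ≤ 4 ∧
      ∀ S : P, 2 • S ∈ T → (fun σ ↦ ρ σ S - S) ∈ 𝒱 := by
  classical
  -- the Kummer class as a homomorphism `κ : P →+ (G → P)`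
  let κ : P →+ (G → P) :=
    { toFun := fun S σ ↦ ρ σ S - S
      map_zero' := by funext σ; simp
      map_add' := fun S S' ↦ by funext σ; simp only [map_add, Pi.add_apply]; abel }
  -- `H = [2]⁻¹ T`
  let H : AddSubgroup P := T.comap (nsmulAddMonoidHom 2 : P →+ P)
  have hH : ∀ S : P, S ∈ H ↔ 2 • S ∈ T := fun S ↦ by
    simp only [H, AddSubgroup.mem_comap, nsmulAddMonoidHom_apply]
  -- `ψ : H → T ⧸ 2T`, `S ↦ [2S]`; `κ` is constant on the fibres of `ψ`
  set R : AddSubgroup T := (nsmulAddMonoidHom 2 : T →+ T).range with hR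
  have hκT : ∀ x : P, x ∈ T → κ x = 0 := by
    intro x hx
    funext σ
    simp only [κ, AddMonoidHom.coe_mk, ZeroHom.coe_mk, Pi.zero_apply]
    rw [hfix σ _ hx, sub_self]
  have hψ' : ∀ (S S' : P) (hS : 2 • S ∈ T) (hS' : 2 • S' ∈ T),
      (QuotientAddGroup.mk ⟨2 • S, hS⟩ : T ⧸ R) = QuotientAddGroup.mk ⟨2 • S', hS'⟩ → κ S = κ S' := by
    intro S S' hS hS' h
    have h' := (QuotientAddGroup.eq (s := R)).mp h
    obtain ⟨t, ht⟩ := AddMonoidHom.mem_range.mp h'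
    -- `2•t = -(2S) + 2S'` in `P`
    have ht' : (2 : ℕ) • (t : P) = -((2 : ℕ) • S) + (2 : ℕ) • S' := by
      have := congrArg Subtype.val ht
      simpa [nsmulAddMonoidHom_apply] using this
    have h2 : (2 : ℕ) • (S' - S - (t : P)) = 0 := by rw [smul_sub, smul_sub, ht']; abel
    have hmem : S' - S - (t : P) ∈ T := h2tors _ h2
    have hdiff : S' - S ∈ T := by
      have := T.add_mem hmem t.2
      simpa using this
    have := (map_sub κ S' S).symm.trans (hκT _ hdiff)
    exact (sub_eq_zero.mp this).symm
  let ψ : H → T ⧸ R := fun S ↦ QuotientAddGroup.mk ⟨2 • (S : P), (hH S).mp S.2⟩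
  have hψ : ∀ S S' : H, ψ S = ψ S' → κ (S : P) = κ (S' : P) := fun S S' h ↦
    hψ' (S : P) (S' : P) ((hH S).mp S.2) ((hH S').mp S'.2) h
  -- the induced surjection `range ψ → H.map κ`
  let g : Set.range ψ → H.map κ := fun q ↦ ⟨κ (q.2.choose : H), AddSubgroup.mem_map.mpr ⟨_, q.2.choose.2, rfl⟩⟩
  have hg : Function.Surjective g := by
    rintro ⟨v, hv⟩
    obtain ⟨S, hS, rfl⟩ := AddSubgroup.mem_map.mp hv
    refine ⟨⟨ψ ⟨S, hS⟩, ⟨⟨S, hS⟩, rfl⟩⟩, Subtype.ext ?_⟩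
    have hc := (⟨⟨S, hS⟩, rfl⟩ : ∃ x : H, ψ x = ψ ⟨S, hS⟩).choose_spec
    exact hψ _ _ hc
  haveI hfin : Finite (H.map κ) := Finite.of_surjective g hg
  have hcard : Nat.card (H.map κ) ≤ 4 :=
    calc Nat.card (H.map κ) ≤ Nat.card (Set.range ψ) := Nat.card_le_card_of_surjective g hg
      _ ≤ Nat.card (T ⧸ R) := Nat.card_le_card_of_injective _ Subtype.val_injective
      _ = Nat.card (nsmulAddMonoidHom 2 : T →+ T).ker := KummerDiamondStepTwo.card_quotient_two_eq_card_twoTorsion T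
      _ ≤ 4 := h4
  exact ⟨H.map κ, Set.toFinite _, hcard, fun S hS ↦ AddSubgroup.mem_map.mpr ⟨S, (hH S).mpr hS, rfl⟩⟩

/-! ## §2 `|W₀(ℂ)[2]| ≤ 4` by uniformisation -/

variable {N : ℕ} [NeZero N] {W₀ : WeierstrassCurve ℚ} (D₀ : ModularParametrizationData W₀ N)

/-- Half-lattice points uniformise to one of the four `2`-torsion representatives. [folklore] -/
theorem uniformize_half_mem_fourSet {x : ℂ} (hx : x ∈ D₀.L.lattice) :
    D₀.uniformize (x / 2) ∈ ({D₀.uniformize (0 / 2), D₀.uniformize (D₀.L.ω₁ / 2), D₀.uniformize (D₀.L.ω₂ / 2),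
      D₀.uniformize ((D₀.L.ω₁ + D₀.L.ω₂) / 2)} : Set _) := by
  obtain ⟨m, n, hmn⟩ := PeriodPair.mem_lattice.mp hx
  simp only [Set.mem_insert_iff, Set.mem_singleton_iff]
  rw [← hmn]
  have key : ∀ (k l : ℤ) (z t : ℂ), z = (2 * k : ℤ) * D₀.L.ω₁ + (2 * l : ℤ) * D₀.L.ω₂ + t →
      D₀.uniformize (z / 2) = D₀.uniformize (t / 2) := by
    intro k l z t hz
    rw [uniformize_eq_uniformize_iff, PeriodPair.mem_lattice]
    exact ⟨k, l, by rw [hz]; push_cast; ring⟩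
  rcases Int.even_or_odd' m with ⟨k, hk | hk⟩ <;> rcases Int.even_or_odd' n with ⟨l, hl | hl⟩ <;> rw [hk, hl]
  · left; exact key k l _ 0 (by push_cast; ring)
  · right; right; left; exact key k l _ _ (by push_cast; ring)
  · right; left; exact key k l _ _ (by push_cast; ring)
  · right; right; right; exact key k l _ _ (by push_cast; ring)

/-- **`|W₀(ℂ)[2]| ≤ 4`**: the `2`-torsion points of `W₀(ℂ)` are among `π₀(0), π₀(ω₁/2), π₀(ω₂/2), π₀((ω₁+ω₂)/2)`. [cite: SilvermanAEC2009, Prop. X.1.4] -/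
theorem twoTorsion_subset_fourSet :
    {S : (W₀.baseChange ℂ).toAffine.Point | 2 • S = 0} ⊆ ({D₀.uniformize (0 / 2), D₀.uniformize (D₀.L.ω₁ / 2), D₀.uniformize (D₀.L.ω₂ / 2),
      D₀.uniformize ((D₀.L.ω₁ + D₀.L.ω₂) / 2)} : Set _) := by
  intro S hS
  obtain ⟨z, rfl⟩ := D₀.uniformize_surjective S
  have h2 : 2 * z ∈ D₀.L.lattice := by
    rw [← D₀.uniformize_eq_zero_iff, show (2 : ℂ) * z = z + z by ring, map_add]
    simpa [two_nsmul] using hS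
  have h := uniformize_half_mem_fourSet D₀ h2
  rwa [show 2 * z / 2 = z by ring] at h

/-- `{S ∈ W₀(ℂ) : 2S = 0}` is finite with at most four elements. [cite: SilvermanAEC2009, Prop. X.1.4] -/
theorem ncard_twoTorsion_le_four (D₀ : ModularParametrizationData W₀ N) :
    ({S : (W₀.baseChange ℂ).toAffine.Point | 2 • S = 0} : Set _).Finite ∧ ({S : (W₀.baseChange ℂ).toAffine.Point | 2 • S = 0} : Set _).ncard ≤ 4 := by
  have hsub := twoTorsion_subset_fourSet D₀
  refine ⟨Set.Finite.subset (Set.toFinite _) hsub, (Set.ncard_le_ncard hsub (Set.toFinite _)).trans ?_⟩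
  refine (Set.ncard_insert_le _ _).trans ?_
  have h3 := (Set.ncard_insert_le (D₀.uniformize (D₀.L.ω₁ / 2)) ({D₀.uniformize (D₀.L.ω₂ / 2), D₀.uniformize ((D₀.L.ω₁ + D₀.L.ω₂) / 2)} : Set _))
  have h2 := (Set.ncard_insert_le (D₀.uniformize (D₀.L.ω₂ / 2)) ({D₀.uniformize ((D₀.L.ω₁ + D₀.L.ω₂) / 2)} : Set _))
  rw [Set.ncard_singleton] at h2
  omega

/-- **`|T[2]| ≤ 4` for every subgroup `T ≤ W₀(ℂ)`** — the hypothesis `h4` of `exists_kummerSubgroup`. [cite: SilvermanAEC2009, Prop. X.1.4] -/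
theorem natCard_ker_two_le_four (D₀ : ModularParametrizationData W₀ N) (T : AddSubgroup (W₀.baseChange ℂ).toAffine.Point) :
    Nat.card (nsmulAddMonoidHom 2 : T →+ T).ker ≤ 4 := by
  obtain ⟨hfin, hle⟩ := ncard_twoTorsion_le_four D₀
  haveI : Finite ({S : (W₀.baseChange ℂ).toAffine.Point | 2 • S = 0} : Set _) := hfin.to_subtype
  let ι : (nsmulAddMonoidHom 2 : T →+ T).ker → ({S : (W₀.baseChange ℂ).toAffine.Point | 2 • S = 0} : Set _) :=
    fun t ↦ ⟨((t : T) : (W₀.baseChange ℂ).toAffine.Point), by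
      have h := t.2
      rw [AddMonoidHom.mem_ker, nsmulAddMonoidHom_apply] at h
      have h' : (((2 : ℕ) • (t : T) : T) : (W₀.baseChange ℂ).toAffine.Point) = ((0 : T) : (W₀.baseChange ℂ).toAffine.Point) :=
        congrArg Subtype.val h
      rw [AddSubmonoidClass.coe_nsmul, ZeroMemClass.coe_zero] at h'
      exact h'⟩
  have hι : Function.Injective ι := by
    intro a b h
    have h' := congrArg Subtype.val h
    exact Subtype.ext (Subtype.ext h')
  calc Nat.card (nsmulAddMonoidHom 2 : T →+ T).ker ≤ Nat.card ({S : (W₀.baseChange ℂ).toAffine.Point | 2 • S = 0} : Set _) :=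
        Nat.card_le_card_of_injective ι hι
    _ = ({S : (W₀.baseChange ℂ).toAffine.Point | 2 • S = 0} : Set _).ncard := Nat.card_coe_set_eq _
    _ ≤ 4 := hle

end Summit.BirchSwinnertonDyer.BirchSwinnertonDyer.Theorems.ManinLocalTwoThree.StepTwo

end
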